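import Summits.AtomisticToContinuum.Crystallization.Theorems.OverbindingBudgetAffineRunCutSheetWalk

/-!
# `OverbindingBudget` / crux `RobustDefectLimitWindows` (stmt-AtomisticToContinuum-31280) — «RunCut»: SHEET COVER (the walking primitives of the pointwise engine)

Support file (lens-4 g89, part 21 «SHEETCOVER»; memo `g88/memo/SHEETWALK-g88.md` §4, order (2c), radius ruling r1587 (A): ρ₁ = 30; critic row 1596 (A): the
covering constant `κ ≤ 3/4` of `…RunCutCrossCore.crossing_numbers_record` is owed here).  Parts 20A/20B (`…RunCutSheetWalkA/…SheetWalk`) transport scale,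
axis and height along a basal chain of h-sites; this file supplies the ONE walking primitive with which part 22 builds those chains — at each site the walker
takes the best of the SIX BASAL DIRECTIONS of its own hcp chart — and the arithmetic that turns the one-step law into an arrival guarantee.
§1 planar kernel: `hex_core` (`p ≥ q ≥ r`, `p + q + r = 0` ⇒ `(p − r)²/2 ≥ (3/4)(p² + q² + r²)`), `hexDir_model` (`decide`: the six integer vectors
`3(eᵢ − e_k)` are basal points of `hcpModelInt`; cf. `…TwoShellCoverDirections.hcpInt_hex`, another cone), `inner_intVec_right`, `inner_hexDir`, `hex_witness`,
★ `best_of_six` — every `w` of the model's basal plane sees one of the six basal directions `u ∈ hcpTwoShellPattern` at angle `≤ 30°`: `⟪w, u⟫ ≥ 0`,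
`⟪w, u⟫² ≥ (3/4)‖w‖²` (support-function form of `…RunCutCrossCore.hex_support`); `inner_eclipsedVec`.
§2 frames: ★ `best_of_six_frame` — through any linear isometry `Q` of `ℝ³`: a basal `u` with `⟪W, Q u⟫ ≥ 0` and
`⟪W, Q u⟫² ≥ (3/4)(‖W‖² − (3/8)⟪Q a, W⟫²)` (`a = (4,4,4)/√18`, `‖a‖² = 8/3`; pull-back through `LinearIsometry.toLinearIsometryEquiv`,
`⟪Q a, Q u⟫ = 0` by `…SheetWalkA.inner_eclipsed_basal`);
`lateral_sq_step` — `‖lat_n(X − s)‖² = ‖lat_n X‖² − 2⟪lat_n X, s⟫ + (‖s‖² − ⟪n, s⟫²)` (`lat_n X = X − ⟪n, X⟫ n`, `‖n‖ = 1`).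
§3 ONE h-chart `(Q, A, f)` at `m` (pointwise `AffFramed (10⁻⁴, 10⁻³, 1/450)` clauses), `N_m = A a/‖A a‖` its unit axis, `ν = nearestDist y m`:
* `greedy_step` — ★★ GREEDY LATERAL DESCENT: for a unit `n` with `‖N_m ∓ n‖ ≤ 1/50` and ANY `X` (target minus position, `W = lat_n X`) some
  basal `u` gives a site `m′ = f u`, `s = y m′ − y m`, with (i) `⟪W, s⟫ ≥ (43/50) ν ‖W‖, (ii) the ONE-STEP LAW
  `‖lat_n(X − s)‖² ≤ ‖W‖² − (43/25) ν ‖W‖ + 1.0023 ν²`, (iii) `‖s‖ ≤ 1.0011 ν` (rate `0.8647 = (√3/2)√(1 − (3/8)·0.0347²) − 0.0011`,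
  `|⟪Q a, W⟫| ≤ (0.002 + 1.635/50)‖W‖`);
* `steepest_step` — ★★ STEEPEST ASCENT across a foreign plane: for a unit `n` with `|⟪n, N_m⟫| ≤ 19/50` some basal `u` gives `⟪n, s⟫ ≥ (79/100) ν`
  and `‖s‖ ≤ 1.0011 ν` (computed `0.7993`; with `−n` it descends) — the straddle search of the endgame.
§4 arrival arithmetic (pure reals): `descent_law_normalise` — in units of the chain's `ν₀` (window `|ν_t − ν₀| ≤ (0.0026 + 3·10⁻⁴ t)ν₀`, `t ≤ 59`,
`…SheetWalk.sheet_walk_record` (i)) the law reads `R′² ≤ G(R) = R² − (42/25)R + 1.0435`; `stop_radius_le` — at the stop (`R ≤ 16/25`) the lateral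
offset is `≤ (3/4)·ν` of the stopping site: THE COVERING CONSTANT `κ = 3/4`; `envelope_step`, ★ `descent_envelope` — rungs
`τ = (0.64, 0.85, 1.41, 2.12, 2.87, 3.65, 4.44, 5.24)`, `G(τ_k) ≤ τ_{k−1}²`, `G` convex: a hop obeying the law while it runs stops within `7` steps from
`R ≤ 5.24` (`4` from `2.87`, `3` from `2.12`) — the hop lengths of the access / refinement / net walks.
[this file: 0 definitions, 15 theorems; imports tree `…RunCutSheetWalk` only; standard axioms]
-/

namespace Summit.AtomisticToContinuum.Crystallization.Theorems.OverbindingBudgetAffineRunCutSheetCover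

open scoped InnerProductSpace
open Literature.Geometry.DiscreteGeometry
open Summit.AtomisticToContinuum.Crystallization.Theorems.OverbindingBudgetAffineRunCutAxisFingerprint (norm_sq_eclipsedVec)
open Summit.AtomisticToContinuum.Crystallization.Theorems.OverbindingBudgetAffineRunCutSheetLetterA
open Summit.AtomisticToContinuum.Crystallization.Theorems.OverbindingBudgetAffineRunCutSheetWalkA
open Summit.AtomisticToContinuum.Crystallization.Theorems.OverbindingBudgetAffineCompressedCutEstablish (nearestDist_pos_of_frame)

variable {N : ℕ}

local notation "E3" => EuclideanSpace ℝ (Fin 3)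

/-! ## §1 Planar kernel: the regular hexagon of basal directions -/

/-- **Hexagon core inequality.**  For `p ≥ q ≥ r` with `p + q + r = 0`: `p − r ≥ 0` and `(3/4)(p² + q² + r²) ≤ (p − r)²/2`
(the difference is `−(2p + r)(p + 2r)/2 ≥ 0` since `2p + r ≥ 0 ≥ p + 2r`). [this file · kind: proof] -/
theorem hex_core {p q r : ℝ} (hqp : q ≤ p) (hrq : r ≤ q) (h0 : p + q + r = 0) :
    0 ≤ p - r ∧ 3 / 4 * (p ^ 2 + q ^ 2 + r ^ 2) ≤ (p - r) ^ 2 / 2 := by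
  refine ⟨by linarith, ?_⟩
  have h3 : 0 ≤ (2 * p + r) * (-(p + 2 * r)) := mul_nonneg (by linarith) (by linarith)
  rw [show q = -p - r by linarith]; nlinarith [h3]

/-- The integer model: for `i ≠ k` the hexagon vector `3(eᵢ − e_k)` is a point of `hcpModelInt` with coordinate sum `0` (basal)
(cf. the tree's `…OverbindingBudgetTwoShellCoverDirections.hcpInt_hex`, a different import cone). [this file · kind: computation] -/
theorem hexDir_model : ∀ i k : Fin 3, i ≠ k → (3 • (Pi.single i 1 - Pi.single k 1) : Fin 3 → ℤ) ∈ hcpModelInt ∧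
    (3 • (Pi.single i 1 - Pi.single k 1) : Fin 3 → ℤ) 0 + (3 • (Pi.single i 1 - Pi.single k 1) : Fin 3 → ℤ) 1 +
      (3 • (Pi.single i 1 - Pi.single k 1) : Fin 3 → ℤ) 2 = 0 := by
  decide

/-- `⟪u, intVec v⟫ = u₀ v₀ + u₁ v₁ + u₂ v₂` (folklore; identical twins `…PalmUnimodularRigidityShellsToBarlowChart.inner_intVec_right`,
`…ChargedEnergyGapChartDialF.inner_intVec_coord`, `…HullGoodEverywhereDense.hge_inner_intVec` live in other import cones). [this file · kind: glue] -/
theorem inner_intVec_right (u : E3) (v : Fin 3 → ℤ) : ⟪u, intVec v⟫_ℝ = u 0 * v 0 + u 1 * v 1 + u 2 * v 2 := by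
  simp [PiLp.inner_apply, Fin.sum_univ_three, intVec_apply, mul_comm]

/-- `⟪w, 3(eᵢ − e_k)⟫ = 3 (w i − w k)` in the integer model. [this file · kind: glue] -/
theorem inner_hexDir (w : E3) : ∀ i k : Fin 3, ⟪w, intVec (3 • (Pi.single i 1 - Pi.single k 1))⟫_ℝ = 3 * (w i - w k) := by
  intro i k; rw [inner_intVec_right]; fin_cases i <;> fin_cases k <;> simp <;> ring

/-- **The six basal directions.**  For `i ≠ k` the point `u = 3(eᵢ − e_k)/√18` is a basal point of `hcpTwoShellPattern` and
`⟪w, u⟫ = 3(√18)⁻¹ (w i − w k)` (`= (w i − w k)/√2`). [this file · kind: proof] -/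
theorem hex_witness (w : E3) {i k : Fin 3} (hik : i ≠ k) :
    ((Real.sqrt 18)⁻¹ • intVec (3 • (Pi.single i 1 - Pi.single k 1)) : E3) ∈ hcpTwoShellPattern ∧
    ((Real.sqrt 18)⁻¹ • intVec (3 • (Pi.single i 1 - Pi.single k 1)) : E3) 0 +
      ((Real.sqrt 18)⁻¹ • intVec (3 • (Pi.single i 1 - Pi.single k 1)) : E3) 1 +
      ((Real.sqrt 18)⁻¹ • intVec (3 • (Pi.single i 1 - Pi.single k 1)) : E3) 2 = 0 ∧
    ⟪w, ((Real.sqrt 18)⁻¹ • intVec (3 • (Pi.single i 1 - Pi.single k 1)) : E3)⟫_ℝ = 3 * (Real.sqrt 18)⁻¹ * (w i - w k) := by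
  refine ⟨?_, (coordSum_eq_zero_iff _).2 (hexDir_model i k hik).2, by rw [real_inner_smul_right, inner_hexDir]; ring⟩
  rw [hcpTwoShellPattern_eq_image]; simp only [Nat.cast_ofNat]
  exact Finset.mem_image_of_mem _ (hexDir_model i k hik).1

/-- ★ **BEST OF SIX.**  For every vector `w` of the basal plane of the model (`w₀ + w₁ + w₂ = 0`) one of the six basal directions `u` of
`hcpTwoShellPattern` has `⟪w, u⟫ ≥ 0` and `⟪w, u⟫² ≥ (3/4)‖w‖²` — the regular hexagon of unit vectors sees every in-plane direction at an
angle `≤ 30°` (take `i`, `k` the places of the largest and the smallest coordinate and apply `hex_core`). [this file · kind: proof] -/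
theorem best_of_six (w : E3) (hw : w 0 + w 1 + w 2 = 0) :
    ∃ u ∈ hcpTwoShellPattern, u 0 + u 1 + u 2 = 0 ∧ 0 ≤ ⟪w, u⟫_ℝ ∧ 3 / 4 * ‖w‖ ^ 2 ≤ ⟪w, u⟫_ℝ ^ 2 := by
  have hn : ‖w‖ ^ 2 = w 0 ^ 2 + w 1 ^ 2 + w 2 ^ 2 := by
    rw [EuclideanSpace.norm_sq_eq, Fin.sum_univ_three]; simp [Real.norm_eq_abs, sq_abs]
  have h18 : (3 * (Real.sqrt 18)⁻¹) ^ 2 = (1 / 2 : ℝ) := by rw [mul_pow, inv_pow, Real.sq_sqrt (by norm_num)]; norm_num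
  have h18' : (0 : ℝ) ≤ 3 * (Real.sqrt 18)⁻¹ := by positivity
  -- generic ordered case `w i ≥ w j ≥ w k`, then the six orderings of the three coordinates
  have key : ∀ i j k : Fin 3, i ≠ k → w j ≤ w i → w k ≤ w j → w i + w j + w k = 0 → ‖w‖ ^ 2 = w i ^ 2 + w j ^ 2 + w k ^ 2 →
      ∃ u ∈ hcpTwoShellPattern, u 0 + u 1 + u 2 = 0 ∧ 0 ≤ ⟪w, u⟫_ℝ ∧ 3 / 4 * ‖w‖ ^ 2 ≤ ⟪w, u⟫_ℝ ^ 2 := by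
    intro i j k hik hji hkj hs hn'
    obtain ⟨hm, h0, hi⟩ := hex_witness w hik
    obtain ⟨hpos, hc⟩ := hex_core hji hkj hs
    refine ⟨_, hm, h0, by rw [hi]; exact mul_nonneg h18' hpos, ?_⟩
    rw [hi, hn']
    calc 3 / 4 * (w i ^ 2 + w j ^ 2 + w k ^ 2) ≤ (w i - w k) ^ 2 / 2 := hc
      _ = (3 * (Real.sqrt 18)⁻¹ * (w i - w k)) ^ 2 := by rw [mul_pow, h18]; ring
  rcases le_total (w 1) (w 0) with h10 | h01
  · rcases le_total (w 2) (w 1) with h21 | h12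
    · exact key 0 1 2 (by decide) h10 h21 (by linarith) (by rw [hn])
    · rcases le_total (w 2) (w 0) with h20 | h02
      · exact key 0 2 1 (by decide) h20 h12 (by linarith) (by rw [hn]; ring)
      · exact key 2 0 1 (by decide) h02 h10 (by linarith) (by rw [hn]; ring)
  · rcases le_total (w 2) (w 0) with h20 | h02
    · exact key 1 0 2 (by decide) h01 h20 (by linarith) (by rw [hn]; ring)
    · rcases le_total (w 2) (w 1) with h21 | h12
      · exact key 1 2 0 (by decide) h21 h02 (by linarith) (by rw [hn]; ring)
      · exact key 2 1 0 (by decide) h12 h01 (by linarith) (by rw [hn]; ring)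

/-- `⟪(4,4,4)/√18, w⟫ = 4(√18)⁻¹ (w₀ + w₁ + w₂)`: the basal plane of the model is the kernel of the coordinate sum. [this file · kind: glue] -/
theorem inner_eclipsedVec (w : E3) :
    ⟪((Real.sqrt 18)⁻¹ • intVec ![4, 4, 4] : E3), w⟫_ℝ = 4 * (Real.sqrt 18)⁻¹ * (w 0 + w 1 + w 2) := by
  rw [real_inner_smul_left, real_inner_comm, inner_intVec_right]; simp; ring

/-! ## §2 Frames: pulling the hexagon back through a linear isometry -/

/-- ★ **BEST OF SIX THROUGH A FRAME.**  For a linear isometry `Q` of `ℝ³` and any vector `W` there is a basal `u` of `hcpTwoShellPattern` with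
`⟪W, Q u⟫ ≥ 0` and `⟪W, Q u⟫² ≥ (3/4)(‖W‖² − (3/8)⟪Q a, W⟫²)`, `a = (4,4,4)/√18` (`‖a‖² = 8/3`): remove the axial component
`W∥ = W − (3/8)⟪Q a, W⟫ Q a`, pull back `w = Q⁻¹ W∥` (an isometry of `ℝ³` into itself is onto: `LinearIsometry.toLinearIsometryEquiv`),
`w` is in the model's basal plane, and `⟪W, Q u⟫ = ⟪w, u⟫` because `⟪Q a, Q u⟫ = ⟪a, u⟫ = 0` (`…SheetWalkA.inner_eclipsed_basal`).
[this file · kind: proof] -/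
theorem best_of_six_frame (Q : E3 →ₗᵢ[ℝ] E3) (W : E3) :
    ∃ u ∈ hcpTwoShellPattern, u 0 + u 1 + u 2 = 0 ∧ 0 ≤ ⟪W, Q u⟫_ℝ ∧
      3 / 4 * (‖W‖ ^ 2 - 3 / 8 * ⟪Q ((Real.sqrt 18)⁻¹ • intVec ![4, 4, 4]), W⟫_ℝ ^ 2) ≤ ⟪W, Q u⟫_ℝ ^ 2 := by
  set a : E3 := (Real.sqrt 18)⁻¹ • intVec ![4, 4, 4] with hadef
  set c : ℝ := 3 / 8 * ⟪Q a, W⟫_ℝ with hcdef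
  set W' : E3 := W - c • Q a with hW'def
  have ha2 : ‖a‖ ^ 2 = 8 / 3 := by rw [hadef]; exact norm_sq_eclipsedVec
  have hQa2 : ⟪Q a, Q a⟫_ℝ = 8 / 3 := by rw [real_inner_self_eq_norm_sq, Q.norm_map, ha2]
  have hperp : ⟪Q a, W'⟫_ℝ = 0 := by rw [hW'def, inner_sub_right, real_inner_smul_right, hQa2, hcdef]; ring
  -- pull back through the isometry (an equivalence: equal finite dimensions)
  set Qe : E3 ≃ₗᵢ[ℝ] E3 := Q.toLinearIsometryEquiv rfl with hQedef
  have hQe : ∀ x : E3, Qe x = Q x := fun x => rfl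
  set w : E3 := Qe.symm W' with hwdef
  have hQw : Q w = W' := by rw [← hQe, hwdef, Qe.apply_symm_apply]
  have hw0 : w 0 + w 1 + w 2 = 0 := by
    have h1 : ⟪a, w⟫_ℝ = 0 := by rw [← Q.inner_map_map, hQw, hperp]
    rw [inner_eclipsedVec] at h1
    exact (mul_eq_zero.1 h1).resolve_left (mul_ne_zero four_ne_zero (inv_ne_zero (Real.sqrt_ne_zero'.2 (by norm_num))))
  obtain ⟨u, hu, hu0, hpos, hsq⟩ := best_of_six w hw0
  have hinner : ⟪W, Q u⟫_ℝ = ⟪w, u⟫_ℝ := by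
    have e : W = W' + c • Q a := by rw [hW'def]; abel
    rw [e, inner_add_left, real_inner_smul_left, Q.inner_map_map, inner_eclipsed_basal hu hu0, mul_zero, add_zero, ← hQw, Q.inner_map_map]
  have hnorm : ‖w‖ ^ 2 = ‖W‖ ^ 2 - 3 / 8 * ⟪Q a, W⟫_ℝ ^ 2 := by
    have h1 : ‖w‖ = ‖W'‖ := by rw [hwdef, LinearIsometryEquiv.norm_map]
    rw [h1, hW'def, norm_sub_sq_real, real_inner_smul_right, norm_smul, mul_pow, Real.norm_eq_abs, sq_abs, Q.norm_map, ha2,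
      real_inner_comm (Q a) W, hcdef]
    ring
  exact ⟨u, hu, hu0, by rw [hinner]; exact hpos, by rw [hinner, ← hnorm]; exact hsq⟩

/-- **Lateral parts along a step.**  For a unit `n`, `lat X := X − ⟪n, X⟫ n`: `‖lat (X − s)‖² = ‖lat X‖² − 2⟪lat X, s⟫ + (‖s‖² − ⟪n, s⟫²)`
(`⟪lat X, n⟫ = 0`, `‖lat s‖² = ‖s‖² − ⟪n, s⟫²`). [this file · kind: glue] -/
theorem lateral_sq_step {n : E3} (hn : ‖n‖ = 1) (X s : E3) :
    ‖(X - s) - ⟪n, X - s⟫_ℝ • n‖ ^ 2 = ‖X - ⟪n, X⟫_ℝ • n‖ ^ 2 - 2 * ⟪X - ⟪n, X⟫_ℝ • n, s⟫_ℝ + (‖s‖ ^ 2 - ⟪n, s⟫_ℝ ^ 2) := by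
  have hnn : ⟪n, n⟫_ℝ = 1 := by rw [real_inner_self_eq_norm_sq, hn]; norm_num
  have h1 : (X - s) - ⟪n, X - s⟫_ℝ • n = (X - ⟪n, X⟫_ℝ • n) - (s - ⟪n, s⟫_ℝ • n) := by rw [inner_sub_right, sub_smul]; abel
  have hWn : ⟪X - ⟪n, X⟫_ℝ • n, n⟫_ℝ = 0 := by
    rw [inner_sub_left, real_inner_smul_left, hnn, mul_one, real_inner_comm n X, sub_self]
  have h2 : ⟪X - ⟪n, X⟫_ℝ • n, s - ⟪n, s⟫_ℝ • n⟫_ℝ = ⟪X - ⟪n, X⟫_ℝ • n, s⟫_ℝ := by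
    rw [inner_sub_right, real_inner_smul_right, hWn, mul_zero, sub_zero]
  have h3 : ‖s - ⟪n, s⟫_ℝ • n‖ ^ 2 = ‖s‖ ^ 2 - ⟪n, s⟫_ℝ ^ 2 := by
    rw [norm_sub_sq_real, real_inner_smul_right, norm_smul, mul_pow, Real.norm_eq_abs, sq_abs, hn, real_inner_comm n s]; ring
  rw [h1, norm_sub_sq_real, h2, h3]

/-! ## §3 The two chart-level walking primitives -/

section Chart

/-! ONE h-chart `(Q, A, f)` at the site `m` (pointwise `AffFramed (10⁻⁴, 10⁻³, 1/450)` data with `P = hcp`; the exhaustiveness clause is not needed). -/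
variable {y : Fin N → E3} (hy : Function.Injective y) {m : Fin N}
  {Q : E3 →ₗᵢ[ℝ] E3} {A : E3 →ₗ[ℝ] E3} {f : E3 → E3}
  (hA : ∀ v ∈ hcpTwoShellPattern, ‖A v - Q v‖ ≤ 1 / 1000)
  (hf : ∀ v ∈ hcpTwoShellPattern, f v ∈ Set.range y ∧ dist (f v) (y m + nearestDist y m • A v) ≤ 1 / 10 ^ 4 * nearestDist y m)
  (hinj : Set.InjOn f ↑hcpTwoShellPattern)

include hy hA hf hinj

/-- ★★ **GREEDY LATERAL DESCENT (one step).**  `n` a unit reference normal with `‖N_m − σ n‖ ≤ 1/50` for the local unit axis `N_m = A a/‖A a‖`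
(`σ = ±1`), `X` any vector, `W = X − ⟪n, X⟫ n` its lateral part.  Some basal direction `u` of the chart leads to a site `m′ = f u` with
(i) `⟪W, y m′ − y m⟫ ≥ (43/50) ν_m ‖W‖, (ii) the one-step law `‖lat_n(X − (y m′ − y m))‖² ≤ ‖W‖² − (43/25) ν_m ‖W‖ + (10023/10000) ν_m²`,
(iii) `‖y m′ − y m‖ ≤ 1.0011 ν_m`.  (Budget: `|⟪Q a, W⟫| ≤ (0.002 + 1.635/50)‖W‖ = 0.0347‖W‖`, `best_of_six_frame` ⇒ `⟪W, Q u⟫ ≥ 0.8658‖W‖`,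
frame `θ = 10⁻³` and registration `η = 10⁻⁴` ⇒ rate `0.8647 ≥ 43/50`; `‖s‖ ≤ 1.0011 ν_m`.) [this file · kind: proof] -/
theorem greedy_step {n : E3} (hn : ‖n‖ = 1) {σ : ℝ} (hσ : σ = 1 ∨ σ = -1)
    (hNn : ‖(‖A ((Real.sqrt 18)⁻¹ • intVec ![4, 4, 4])‖⁻¹ • A ((Real.sqrt 18)⁻¹ • intVec ![4, 4, 4]) : E3) - σ • n‖ ≤ 1 / 50) (X : E3) :
    ∃ u ∈ hcpTwoShellPattern, u 0 + u 1 + u 2 = 0 ∧ ∀ m' : Fin N, f u = y m' →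
      43 / 50 * nearestDist y m * ‖X - ⟪n, X⟫_ℝ • n‖ ≤ ⟪X - ⟪n, X⟫_ℝ • n, y m' - y m⟫_ℝ ∧
      ‖(X - (y m' - y m)) - ⟪n, X - (y m' - y m)⟫_ℝ • n‖ ^ 2 ≤
        ‖X - ⟪n, X⟫_ℝ • n‖ ^ 2 - 43 / 25 * nearestDist y m * ‖X - ⟪n, X⟫_ℝ • n‖ + 10023 / 10000 * nearestDist y m ^ 2 ∧
      ‖y m' - y m‖ ≤ 10011 / 10000 * nearestDist y m := by
  have _hσ := hσ
  set ν := nearestDist y m with hνdef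
  set a : E3 := (Real.sqrt 18)⁻¹ • intVec ![4, 4, 4] with hadef
  set W : E3 := X - ⟪n, X⟫_ℝ • n with hWdef
  have hν : 0 < ν := nearestDist_pos_of_frame hy (Or.inr rfl) (fun v hv => (hf v hv).1) hinj
  obtain ⟨hAaL, hAaU⟩ := frame_axis_norm (frame_axis_close hA)
  rw [← hadef] at hAaL hAaU
  have hAQ : ‖A a - Q a‖ ≤ 2 / 1000 := frame_axis_close hA
  have hApos : 0 < ‖A a‖ := by linarith
  have hnW : ⟪n, W⟫_ℝ = 0 := by
    rw [hWdef, inner_sub_right, real_inner_smul_right, real_inner_self_eq_norm_sq, hn, one_pow, mul_one, sub_self]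
  -- the axial component of `W` in the frame is small: `|⟪Q a, W⟫| ≤ 0.0347 ‖W‖`
  have hQaW : |⟪Q a, W⟫_ℝ| ≤ 347 / 10000 * ‖W‖ := by
    have e1 : ⟪Q a, W⟫_ℝ = ⟪Q a - A a, W⟫_ℝ + ‖A a‖ * ⟪(‖A a‖⁻¹ • A a : E3) - σ • n, W⟫_ℝ := by
      rw [inner_sub_left (‖A a‖⁻¹ • A a), real_inner_smul_left, real_inner_smul_left, hnW, mul_zero, sub_zero, ← mul_assoc,
        mul_inv_cancel₀ hApos.ne', one_mul, inner_sub_left, sub_add_cancel]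
    have t1 : |⟪Q a - A a, W⟫_ℝ| ≤ 2 / 1000 * ‖W‖ :=
      (abs_real_inner_le_norm _ _).trans (mul_le_mul_of_nonneg_right (by rwa [norm_sub_rev]) (norm_nonneg _))
    have t2 : |⟪(‖A a‖⁻¹ • A a : E3) - σ • n, W⟫_ℝ| ≤ 1 / 50 * ‖W‖ :=
      (abs_real_inner_le_norm _ _).trans (mul_le_mul_of_nonneg_right hNn (norm_nonneg _))
    have t3 := mul_le_mul hAaU t2 (abs_nonneg _) (by norm_num)
    rw [e1]; refine (abs_add_le _ _).trans ?_; rw [abs_mul, abs_of_pos hApos]; linarith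
  -- the best basal direction of the frame: `⟪W, Q u⟫ ≥ 0.8658 ‖W‖`
  obtain ⟨u, hu, hu0, hpos, hsq⟩ := best_of_six_frame Q W
  rw [← hadef] at hsq
  have hQu : 8658 / 10000 * ‖W‖ ≤ ⟪W, Q u⟫_ℝ := by
    have hb : ⟪Q a, W⟫_ℝ ^ 2 ≤ (347 / 10000 * ‖W‖) ^ 2 := by rw [← sq_abs]; exact pow_le_pow_left₀ (abs_nonneg _) hQaW 2
    have hsq' : (8658 / 10000 * ‖W‖) ^ 2 ≤ ⟪W, Q u⟫_ℝ ^ 2 := by nlinarith [hsq, hb, sq_nonneg ‖W‖]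
    exact (pow_le_pow_iff_left₀ (by positivity) hpos two_ne_zero).1 hsq'
  refine ⟨u, hu, hu0, fun m' hm' => ?_⟩
  set s : E3 := y m' - y m with hsdef
  -- registration and frame at `u`: `‖s − ν A u‖ ≤ 10⁻⁴ ν`, `‖A u − Q u‖ ≤ 10⁻³`, `‖u‖ = 1`, `‖s‖ ≤ 1.0011 ν`
  have K1 : ‖s - ν • A u‖ ≤ 1 / 10 ^ 4 * ν := by have := (hf u hu).2; rwa [hm', dist_eq_norm, ← sub_sub] at this
  have hAuQ : ‖A u - Q u‖ ≤ 1 / 1000 := hA u hu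
  have hs : ‖s‖ ≤ 10011 / 10000 * ν := by
    have hAu : ‖A u‖ ≤ 1001 / 1000 := by
      have h := (abs_norm_sub_norm_le (A u) (Q u)).trans hAuQ
      rw [Q.norm_map, norm_eq_one_of_basal hu hu0, abs_le] at h
      linarith [h.2]
    have h1 : ‖s‖ ≤ ‖s - ν • A u‖ + ‖ν • A u‖ := by have := norm_add_le (s - ν • A u) (ν • A u); rwa [sub_add_cancel] at this
    rw [norm_smul, Real.norm_of_nonneg hν.le] at h1
    nlinarith [hAu, hν.le, K1]
  -- (i) the progress inequality `⟪W, s⟫ ≥ 0.8647 ν ‖W‖`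
  have hWs : 8647 / 10000 * ν * ‖W‖ ≤ ⟪W, s⟫_ℝ := by
    have e : ⟪W, s⟫_ℝ = ⟪W, s - ν • A u⟫_ℝ + ν * (⟪W, Q u⟫_ℝ + ⟪W, A u - Q u⟫_ℝ) := by
      rw [inner_sub_right W s, real_inner_smul_right, inner_sub_right W (A u)]; ring
    have t1 : |⟪W, s - ν • A u⟫_ℝ| ≤ ‖W‖ * (1 / 10 ^ 4 * ν) := (abs_real_inner_le_norm _ _).trans (mul_le_mul_of_nonneg_left K1 (norm_nonneg _))
    have t2 : |⟪W, A u - Q u⟫_ℝ| ≤ ‖W‖ * (1 / 1000) := (abs_real_inner_le_norm _ _).trans (mul_le_mul_of_nonneg_left hAuQ (norm_nonneg _))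
    rw [abs_le] at t1 t2
    rw [e]; linarith [t1.1, mul_le_mul_of_nonneg_left hQu hν.le, mul_le_mul_of_nonneg_left t2.1 hν.le]
  have hνW : 0 ≤ ν * ‖W‖ := mul_nonneg hν.le (norm_nonneg W)
  refine ⟨by linarith [hWs, hνW], ?_, hs⟩
  -- (ii) the one-step law
  have hs2 : ‖s‖ ^ 2 ≤ (10011 / 10000 * ν) ^ 2 := pow_le_pow_left₀ (norm_nonneg s) hs 2
  rw [lateral_sq_step hn X s]
  nlinarith [hWs, hs2, sq_nonneg ⟪n, s⟫_ℝ, hνW, sq_nonneg ν]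

/-- ★★ **STEEPEST ASCENT ACROSS A FOREIGN PLANE (one step).**  `n` a unit vector with `|⟪n, N_m⟫| ≤ 19/50` against the local unit axis
`N_m = A a/‖A a‖` (two `{111}` families: `|cos| = 1/3`, plus quantisation, frame and transport slack).  Some basal direction `u` of the chart
leads to a site `m′ = f u` with `⟪n, y m′ − y m⟫ ≥ (79/100) ν_m` and `‖y m′ − y m‖ ≤ 1.0011 ν_m`; with `−n` in place of `n` the step DEscends by as
much.  (Budget: `|⟪Q a, n⟫| ≤ 1.635·19/50 + 0.002 = 0.6233`, `best_of_six_frame` ⇒ `⟪n, Q u⟫² ≥ (3/4)(1 − (3/8)·0.6233²) ≥ 0.8004²`, minus `0.0011`.)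
[this file · kind: proof] -/
theorem steepest_step {n : E3} (hn : ‖n‖ = 1)
    (htilt : |⟪n, (‖A ((Real.sqrt 18)⁻¹ • intVec ![4, 4, 4])‖⁻¹ • A ((Real.sqrt 18)⁻¹ • intVec ![4, 4, 4]) : E3)⟫_ℝ| ≤ 19 / 50) :
    ∃ u ∈ hcpTwoShellPattern, u 0 + u 1 + u 2 = 0 ∧ ∀ m' : Fin N, f u = y m' →
      79 / 100 * nearestDist y m ≤ ⟪n, y m' - y m⟫_ℝ ∧ ‖y m' - y m‖ ≤ 10011 / 10000 * nearestDist y m := by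
  set ν := nearestDist y m with hνdef
  set a : E3 := (Real.sqrt 18)⁻¹ • intVec ![4, 4, 4] with hadef
  have hν : 0 < ν := nearestDist_pos_of_frame hy (Or.inr rfl) (fun v hv => (hf v hv).1) hinj
  obtain ⟨hAaL, hAaU⟩ := frame_axis_norm (frame_axis_close hA)
  rw [← hadef] at hAaL hAaU
  have hAQ : ‖A a - Q a‖ ≤ 2 / 1000 := frame_axis_close hA
  have hApos : 0 < ‖A a‖ := by linarith
  have hn2 : ‖n‖ ^ 2 = 1 := by rw [hn]; norm_num
  -- the axial component of `n` in the frame: `|⟪Q a, n⟫| ≤ 0.6233`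
  have hQan : |⟪Q a, n⟫_ℝ| ≤ 6233 / 10000 := by
    have e1 : ⟪Q a, n⟫_ℝ = ⟪Q a - A a, n⟫_ℝ + ‖A a‖ * ⟪n, (‖A a‖⁻¹ • A a : E3)⟫_ℝ := by
      rw [real_inner_smul_right, ← mul_assoc, mul_inv_cancel₀ hApos.ne', one_mul, inner_sub_left, real_inner_comm (A a) n, sub_add_cancel]
    have t1 : |⟪Q a - A a, n⟫_ℝ| ≤ 2 / 1000 * 1 := by
      refine (abs_real_inner_le_norm _ _).trans ?_; rw [hn]; exact mul_le_mul_of_nonneg_right (by rwa [norm_sub_rev]) zero_le_one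
    have t3 := mul_le_mul hAaU htilt (abs_nonneg _) (by norm_num)
    rw [e1]; refine (abs_add_le _ _).trans ?_; rw [abs_mul, abs_of_pos hApos]; linarith
  obtain ⟨u, hu, hu0, hpos, hsq⟩ := best_of_six_frame Q n
  rw [← hadef, hn2] at hsq
  have hQu : 8004 / 10000 ≤ ⟪n, Q u⟫_ℝ := by
    have hb : ⟪Q a, n⟫_ℝ ^ 2 ≤ (6233 / 10000) ^ 2 := by rw [← sq_abs]; exact pow_le_pow_left₀ (abs_nonneg _) hQan 2
    have hsq' : (8004 / 10000 : ℝ) ^ 2 ≤ ⟪n, Q u⟫_ℝ ^ 2 := by nlinarith [hsq, hb]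
    exact (pow_le_pow_iff_left₀ (by positivity) hpos two_ne_zero).1 hsq'
  refine ⟨u, hu, hu0, fun m' hm' => ?_⟩
  set s : E3 := y m' - y m with hsdef
  have K1 : ‖s - ν • A u‖ ≤ 1 / 10 ^ 4 * ν := by have := (hf u hu).2; rwa [hm', dist_eq_norm, ← sub_sub] at this
  have hAuQ : ‖A u - Q u‖ ≤ 1 / 1000 := hA u hu
  have hs : ‖s‖ ≤ 10011 / 10000 * ν := by
    have hAu : ‖A u‖ ≤ 1001 / 1000 := by
      have h := (abs_norm_sub_norm_le (A u) (Q u)).trans hAuQ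
      rw [Q.norm_map, norm_eq_one_of_basal hu hu0, abs_le] at h
      linarith [h.2]
    have h1 : ‖s‖ ≤ ‖s - ν • A u‖ + ‖ν • A u‖ := by have := norm_add_le (s - ν • A u) (ν • A u); rwa [sub_add_cancel] at this
    rw [norm_smul, Real.norm_of_nonneg hν.le] at h1
    nlinarith [hAu, hν.le, K1]
  refine ⟨?_, hs⟩
  have e : ⟪n, s⟫_ℝ = ⟪n, s - ν • A u⟫_ℝ + ν * (⟪n, Q u⟫_ℝ + ⟪n, A u - Q u⟫_ℝ) := by
    rw [inner_sub_right n s, real_inner_smul_right, inner_sub_right n (A u)]; ring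
  have t1 : |⟪n, s - ν • A u⟫_ℝ| ≤ 1 * (1 / 10 ^ 4 * ν) := by
    refine (abs_real_inner_le_norm _ _).trans ?_; rw [hn]; exact mul_le_mul_of_nonneg_left K1 zero_le_one
  have t2 : |⟪n, A u - Q u⟫_ℝ| ≤ 1 * (1 / 1000) := by
    refine (abs_real_inner_le_norm _ _).trans ?_; rw [hn]; exact mul_le_mul_of_nonneg_left hAuQ zero_le_one
  rw [abs_le] at t1 t2
  rw [e]; linarith [t1.1, mul_le_mul_of_nonneg_left hQu hν.le, mul_le_mul_of_nonneg_left t2.1 hν.le]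

end Chart

/-! ## §4 Arrival arithmetic: the normalised law, the stop radius and the descent envelope -/

/-- **The one-step law in units of the chain's first scale.**  If `r′² ≤ r² − (43/25) ν r + (10023/10000) ν²` (`greedy_step` (ii) at a site of scale
`ν`) and `|ν − ν₀| ≤ (0.0026 + 3·10⁻⁴ t) ν₀` with `t ≤ 59` (`…SheetWalk.sheet_walk_record` (i) at the step's origin), then
`R′² ≤ R² − (42/25) R + 10435/10000 =: G(R)` for `R = r/ν₀`, `R′ = r′/ν₀` (`ν ∈ [0.9797, 1.0203] ν₀`: `1.72·0.9797 = 1.685 ≥ 1.68`,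
`1.0023·1.0203² = 1.0434 ≤ 1.0435`). [this file · kind: glue] -/
theorem descent_law_normalise {r r' ν ν₀ : ℝ} {t : ℕ} (hν₀ : 0 < ν₀) (hr : 0 ≤ r) (ht : t ≤ 59)
    (hwin : |ν - ν₀| ≤ (26 / 10000 + 3 / 10000 * t) * ν₀) (h : r' ^ 2 ≤ r ^ 2 - 43 / 25 * ν * r + 10023 / 10000 * ν ^ 2) :
    (r' / ν₀) ^ 2 ≤ (r / ν₀) ^ 2 - 42 / 25 * (r / ν₀) + 10435 / 10000 := by
  have ht' : (t : ℝ) ≤ 59 := by exact_mod_cast ht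
  have hw : |ν - ν₀| ≤ 203 / 10000 * ν₀ := hwin.trans (by nlinarith [hν₀.le, ht'])
  rw [abs_le] at hw
  have hlo : 9797 / 10000 * ν₀ ≤ ν := by linarith [hw.1]
  have hhi : ν ≤ 10203 / 10000 * ν₀ := by linarith [hw.2]
  have key : r' ^ 2 ≤ r ^ 2 - 42 / 25 * ν₀ * r + 10435 / 10000 * ν₀ ^ 2 := by
    have h1 : 42 / 25 * ν₀ * r ≤ 43 / 25 * ν * r := by nlinarith [hlo, hr]
    have h2 : ν ^ 2 ≤ (10203 / 10000 * ν₀) ^ 2 := pow_le_pow_left₀ (by linarith) hhi 2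
    nlinarith [h, h1, h2]
  have e2 : (r / ν₀) ^ 2 - 42 / 25 * (r / ν₀) + 10435 / 10000 = (r ^ 2 - 42 / 25 * ν₀ * r + 10435 / 10000 * ν₀ ^ 2) / ν₀ ^ 2 := by
    field_simp
  rw [div_pow, e2]
  exact div_le_div_of_nonneg_right key (pow_pos hν₀ 2).le

/-- **The stop radius is a covering constant `κ ≤ 3/4`.**  At the stopping site (`R = r/ν₀ ≤ 16/25`, any `t ≤ 60` of the chain's window) the lateral
offset is `r ≤ (3/4) ν` in units of THAT site's scale (`0.64/0.9794 = 0.6535 ≤ 3/4`): the `κ` of `…RunCutCrossCore.crossing_numbers_record`.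
[this file · kind: glue] -/
theorem stop_radius_le {r ν ν₀ : ℝ} {t : ℕ} (hν₀ : 0 < ν₀) (ht : t ≤ 60) (hwin : |ν - ν₀| ≤ (26 / 10000 + 3 / 10000 * t) * ν₀)
    (hR : r / ν₀ ≤ 16 / 25) : r ≤ 3 / 4 * ν := by
  have ht' : (t : ℝ) ≤ 60 := by exact_mod_cast ht
  have hw : |ν - ν₀| ≤ 206 / 10000 * ν₀ := hwin.trans (by nlinarith [hν₀.le, ht'])
  rw [abs_le] at hw
  rw [div_le_iff₀ hν₀] at hR
  linarith [hw.1]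

/-- **Envelope step (convexity of `G(R) = R² − (42/25)R + 10435/10000`).**  If `R ≤ b`, the law holds above the threshold `16/25`, and both
`G(b) ≤ c²` and `G(16/25) = 0.3779 ≤ c²` (`c ≥ 0`), then `R ≤ 16/25` or `R′ ≤ c` (on `[16/25, b]` the convex `G` is below its chord).
[this file · kind: glue] -/
theorem envelope_step {R R' b c : ℝ} (hR' : 0 ≤ R') (hG : 16 / 25 < R → R' ^ 2 ≤ R ^ 2 - 42 / 25 * R + 10435 / 10000)
    (hRb : R ≤ b) (hc : 0 ≤ c) (hbc : b ^ 2 - 42 / 25 * b + 10435 / 10000 ≤ c ^ 2) (hc0 : (3779 / 10000 : ℝ) ≤ c ^ 2) :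
    R ≤ 16 / 25 ∨ R' ≤ c := by
  rcases le_or_gt R (16 / 25) with h | h
  · exact Or.inl h
  · right
    have h1 := hG h
    have H1 : 0 ≤ (R - 16 / 25) * (b - R) := mul_nonneg (by linarith) (by linarith)
    have h2 : R' ^ 2 ≤ c ^ 2 := by
      rcases le_total (26 / 25 : ℝ) b with hb | hb
      · have H2 : 0 ≤ (b - 26 / 25) * (b - R) := mul_nonneg (by linarith) (by linarith)
        nlinarith [h1, H1, H2, hbc]
      · have H3 : 0 ≤ (26 / 25 - b) * (R - 16 / 25) := mul_nonneg (by linarith) (by linarith)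
        nlinarith [h1, H1, H3, hc0]
    exact (pow_le_pow_iff_left₀ hR' hc two_ne_zero).1 h2

/-- ★ **THE DESCENT ENVELOPE (a hop terminates).**  `R` nonnegative; the normalised one-step law is required only WHILE THE HOP RUNS — at the times
`t₀ + s`, `s < T` (the horizon for which the walker is known to have a chart), at which no earlier time of the hop has reached the stop threshold
`16/25`.  Then from `R t₀ ≤ 131/25 = 5.24` the hop stops (`R ≤ 16/25`) within `7` steps (needs `T ≥ 7`), from `R t₀ ≤ 287/100` within `4`, from
`R t₀ ≤ 53/25` within `3`: the rungs `τ = (0.64, 0.85, 1.41, 2.12, 2.87, 3.65, 4.44, 5.24)` satisfy `G(τ_k) ≤ τ_{k−1}²` (exact decimals; `k = 5` is the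
tight one, `8.234 ≤ 8.2369`) and `envelope_step` descends one rung per step.  (Access hops `≤ 4.6 + 0.64 = 5.24`, refinement `2.12`, nets `2.87`:
memo SHEETWALK-g88 §4.) [this file · kind: proof] -/
theorem descent_envelope (R : ℕ → ℝ) (t₀ T : ℕ) (h0 : ∀ t, 0 ≤ R t)
    (h : ∀ s, s < T → (∀ s', s' ≤ s → 16 / 25 < R (t₀ + s')) → R (t₀ + s + 1) ^ 2 ≤ R (t₀ + s) ^ 2 - 42 / 25 * R (t₀ + s) + 10435 / 10000) :
    (7 ≤ T → R t₀ ≤ 131 / 25 → ∃ s, s ≤ 7 ∧ R (t₀ + s) ≤ 16 / 25) ∧ (4 ≤ T → R t₀ ≤ 287 / 100 → ∃ s, s ≤ 4 ∧ R (t₀ + s) ≤ 16 / 25) ∧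
    (3 ≤ T → R t₀ ≤ 53 / 25 → ∃ s, s ≤ 3 ∧ R (t₀ + s) ≤ 16 / 25) := by
  -- one rung: if from `R ≤ c` the hop stops within `k` steps, then from `R ≤ b` (`G(b) ≤ c²`) it stops within `k + 1`
  have rung : ∀ (b c : ℝ) (k : ℕ), 0 ≤ c → b ^ 2 - 42 / 25 * b + 10435 / 10000 ≤ c ^ 2 → (3779 / 10000 : ℝ) ≤ c ^ 2 →
      (∀ s, s + k ≤ T → (∀ s', s' < s → 16 / 25 < R (t₀ + s')) → R (t₀ + s) ≤ c → ∃ s'', s'' ≤ k ∧ R (t₀ + s + s'') ≤ 16 / 25) →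
      ∀ s, s + (k + 1) ≤ T → (∀ s', s' < s → 16 / 25 < R (t₀ + s')) → R (t₀ + s) ≤ b → ∃ s'', s'' ≤ k + 1 ∧ R (t₀ + s + s'') ≤ 16 / 25 := by
    intro b c k hc hbc hc0 ih s hsT hprev hsb
    rcases le_or_gt (R (t₀ + s)) (16 / 25) with hstop | hgo
    · exact ⟨0, Nat.zero_le _, by simpa using hstop⟩
    · have hall : ∀ s', s' ≤ s → 16 / 25 < R (t₀ + s') := fun s' hs' => (Nat.lt_or_eq_of_le hs').elim (hprev s') (fun e => e ▸ hgo)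
      rcases envelope_step (h0 (t₀ + s + 1)) (fun _ => h s (by omega) hall) hsb hc hbc hc0 with hs' | hs'
      · exact absurd hs' (not_le.2 hgo)
      · obtain ⟨s'', hk, hR⟩ := ih (s + 1) (by omega) (fun s' hs' => hall s' (by omega)) (by rw [← add_assoc]; exact hs')
        exact ⟨s'' + 1, by omega, by rw [show t₀ + s + (s'' + 1) = t₀ + (s + 1) + s'' by omega]; exact hR⟩
  have r0 : ∀ s, s + 0 ≤ T → (∀ s', s' < s → 16 / 25 < R (t₀ + s')) → R (t₀ + s) ≤ 16 / 25 → ∃ s'', s'' ≤ 0 ∧ R (t₀ + s + s'') ≤ 16 / 25 :=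
    fun s _ _ hs => ⟨0, le_rfl, by simpa using hs⟩
  have r1 := rung (17 / 20) (16 / 25) 0 (by norm_num) (by norm_num) (by norm_num) r0
  have r2 := rung (141 / 100) (17 / 20) 1 (by norm_num) (by norm_num) (by norm_num) r1
  have r3 := rung (53 / 25) (141 / 100) 2 (by norm_num) (by norm_num) (by norm_num) r2
  have r4 := rung (287 / 100) (53 / 25) 3 (by norm_num) (by norm_num) (by norm_num) r3
  have r5 := rung (73 / 20) (287 / 100) 4 (by norm_num) (by norm_num) (by norm_num) r4
  have r6 := rung (111 / 25) (73 / 20) 5 (by norm_num) (by norm_num) (by norm_num) r5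
  have r7 := rung (131 / 25) (111 / 25) 6 (by norm_num) (by norm_num) (by norm_num) r6
  have hnone : ∀ s', s' < 0 → 16 / 25 < R (t₀ + s') := fun s' hs' => absurd hs' (Nat.not_lt_zero _)
  refine ⟨fun hT hR0 => ?_, fun hT hR0 => ?_, fun hT hR0 => ?_⟩
  · obtain ⟨s, hs, hR⟩ := r7 0 (by omega) hnone (by simpa using hR0); exact ⟨s, hs, by simpa using hR⟩
  · obtain ⟨s, hs, hR⟩ := r4 0 (by omega) hnone (by simpa using hR0); exact ⟨s, hs, by simpa using hR⟩
  · obtain ⟨s, hs, hR⟩ := r3 0 (by omega) hnone (by simpa using hR0); exact ⟨s, hs, by simpa using hR⟩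

end Summit.AtomisticToContinuum.Crystallization.Theorems.OverbindingBudgetAffineRunCutSheetCover
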